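/-
Copyright (c) 2026 the pub-hodgecm-mathlib formalisation cell (harness21).  Prover seat hodgecm-mathlib-LH4-p11 (g8), Track A «(D-RAM) FOUR-FRAME» squad, helper lane on
h413 = stmt-HodgeConjecture-24833 (count-neutral).  Heir dealer∕pen LH4-plan (g13) WORD #70 (2) «(β-BAL) producer»; SCOPE-betaBAL v1 91e23c08 (R2) ∕ brick B4a.  2026-09-04.
-/
import Summits.HodgeConjecture.HodgeConjecture.Theorems.F0P3cDyRamCleanLabelCountDiagonalModel   -- ★ p860071 (this seat, (β-BAL-1)): `exists_diagonal_model_cleanLabelFixCount`, `ncard_cleanLabel_diagonal_eq_of_exists_norm`, `ncard_cleanLabel_diagonal_smul_form`;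
                                                                                                 -- brings ★ №7 `cleanLabelFixCount`, `CleanLabelKappaBalanceLawAt`, ★ (L-lab-7), ★ `exists_unimodular_diagonal_frame`
import Summits.HodgeConjecture.HodgeConjecture.Theorems.F0P3cDyRamEightfoldOddCharacterSocket     -- ★ p860090 (this seat, (β-BAL-0)): `sum_kappaChar_mul_eq_sum_kappaChar_mul_compl`
import Summits.HodgeConjecture.HodgeConjecture.Theorems.F0P3cDyRamStableSumSignClasses           -- ★ p855115 (LH4-p10): `normSign_eq_one_or`, `exists_norm_of_normSign_eq_one`, `not_exists_norm_of_normSign_eq_neg_one`, `exists_rep_of_dichotomy`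
import Summits.HodgeConjecture.HodgeConjecture.Theorems.F0P3cDyRamNormIndexTwo                  -- ★ p855402 (F0P3-p01): (NI2) `normIndexTwo`
import Summits.HodgeConjecture.HodgeConjecture.Theorems.F0P3cDyRamFourFrameLawDefs              -- ★ №1: `DyadicFence`
import HarnessLib

/-!
# Crux `H413`, line LH4 «(D-RAM) FOUR-FRAME» — (β-BAL-4a) «(β-BAL) FROM THE EIGHTFOLD ODD-CHARACTER VANISHING»: the four-frame κ-balance of the two label classes on the clean
# shell follows, at ANY schedules `(N₀, mc)`, from ONE frame-free statement in the unimodular diagonal model — for every `σ`-fixed non-norm unit `u`, every element datum and each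
# slot `i`, the signed sum over the eight sign patterns `s` of the class-`+` clean-shell counts of `diag(u^{s})` with the sign `(−1)^{s_i}` vanishes

Cell `hodgecm-mathlib` (D-0151), FLOOR 0, crux item H413 = `stmt-HodgeConjecture-24833`, route `HCCMUnconditional`; squad F0∕P3c∕LH4.  THEOREMS ONLY (no `def`, no instance,
no notation, no `sorry`, default heartbeats); ★-only imports; lane `--supports stmt-HodgeConjecture-24833 --as helper` (count-neutral); pays NO row, states NO law (the
eightfold vanishing is a HYPOTHESIS here — the producer target of bricks B2∕B3).

THE REDUCTION (SCOPE-betaBAL v1 (R2)).  Frame `b` of a type-(1) four-frame family has the unimodular diagonal model `diag(c^{(b)})`, `ω(c^{(b)}_j) = (ε₁, ε₂, ω(−1)ε₁ε₂)_j`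
(★ p860071 §5, one model for every class `e`).  With `u` a `σ`-fixed non-norm unit satisfying the index-two dichotomy (§1: every such `u` does, by ★ NI2), each `c^{(b)}_j` is
congruent to the representative `u^{s_j}`, `s = e_b := (ω(c^{(b)}_j) = −1)_j` (★ `exists_rep_of_dichotomy`), so the class-`+` count of frame `b` is the pattern count `N(e_b)`
(★ p860071 §3); the class-`u` count of frame `b` is the class-`+` count of `diag(u⁻¹c^{(b)})` (★ p860071 §4, the form-scaling flip), i.e. the pattern count `N(ē_b)` of the
COMPLEMENTARY pattern (§2).  The patterns `e_b` have constant parity `[ω(−1) = −1]` (§3), so ★ p860090 `sum_kappaChar_mul_eq_sum_kappaChar_mul_compl` turns the three odd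
sign-character vanishings `Σ_s (−1)^{s_i} N(s) = 0` into `Σ_b κ_i(b)·N(e_b) = Σ_b κ_i(b)·N(ē_b)` — which is (β-BAL) `CleanLabelKappaBalanceLawAt N₀ mc` at the frame (§4 HEAD;
§5 the fenced∕record-letter forms = the type of LH4-p05 (g8)'s `hbal` binder modulo the eightfold statement).
* §1 `dichotomy_of_nonnorm` (the index-two dichotomy transfers from NI2's `c` to ANY fixed non-norm unit `u`), `exists_rep_inv_mul` (the flipped representative).
* §2 `ncard_model_ternary_eq_binary` (★ p860071's generic-`diag(s)` currency at `s = (α, β, 1)` = the binary norm-form currency), `ncard_cleanLabel_binary_eq_of_exists_norm`,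
  `ncard_cleanLabel_binary_smul_form` (★ p860071 §3∕§4 in binary currency).
* §3 `xor_pattern_eq` (parity of the frame patterns).
* §4 HEAD `cleanLabelKappaBalanceLawAt_of_eightfold`.   §5 `dyadicFence_cleanLabelKappaBalanceLawAt_of_eightfold`, `…_derived_ofRecord_of_eightfold`.
HONEST LABEL.  Count-neutral reduction; (β-BAL), (A″), (β) and the tier-0 T₊ row stay OPEN (the eightfold vanishing is not proved here); `HC_CM` is proved only modulo the 7
printed citations (2 remaining named inputs: hLiu418 = `stmt-HodgeConjecture-24832`, h413 = `stmt-HodgeConjecture-24833`) until rung 0 closes.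

## References
* [LanglandsShelstad1987] R. P. Langlands, D. Shelstad, *On the definition of transfer factors*, Math. Ann. 278 (1987), §1.3, §3.
* [Kottwitz1986BaseChangeUnits] R. E. Kottwitz, *Base change for unit elements of Hecke algebras*, Compositio Math. 60 (1986), §1 pp. 240–241.
* [Rogawski1990] J. D. Rogawski, *Automorphic Representations of Unitary Groups in Three Variables*, Ann. of Math. Stud. 123 (1990), §3.6 pp. 28–29, §4.9 Prop. 4.9.1 (a)(b) p. 55.
* [Jacobowitz1962] R. Jacobowitz, *Hermitian forms over local fields*, Amer. J. Math. 84 (1962), §4.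
* [Serre1979] J.-P. Serre, *Local Fields*, GTM 67 (1979), Ch. V §3 Cor. 3 (the norm subgroup of the units has index two).
-/

set_option autoImplicit false

noncomputable section

namespace Summit.HodgeConjecture.HodgeConjecture.Cruxes.H413.F0P3cDyRamCleanLabelBalanceOfEightfold

open Literature.NumberTheory.Automorphic Literature.NumberTheory.Automorphic.HermitianLattice Literature.NumberTheory.Automorphic.UnitaryGroup
open Literature.NumberTheory.Automorphic.UnitaryLatticeTree Literature.NumberTheory.Automorphic.UnitaryThreeFourFrame
open Summit.HodgeConjecture.HodgeConjecture.Cruxes.H413.F0P3cDyRamFourFramePieces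
open Summit.HodgeConjecture.HodgeConjecture.Cruxes.H413.F0P3cDyRamFourFrameCensusDefs
open Summit.HodgeConjecture.HodgeConjecture.Cruxes.H413.F0P3cDyRamFourFrameLawDefs (DyadicFence)
open Summit.HodgeConjecture.HodgeConjecture.Cruxes.H413.F0P3cDyRamStageOneBDefs (mcOfRecord)
open Summit.HodgeConjecture.HodgeConjecture.Cruxes.H413.F0P3cDyRamStageOneBDerivedDefs (n0DerivedOfRecord)
open Summit.HodgeConjecture.HodgeConjecture.Cruxes.H413.F0P3cDyRamCleanLabelDefs
open Summit.HodgeConjecture.HodgeConjecture.Cruxes.H413.F0P3cDyRamCleanLabelCountDiagonalModel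
open Summit.HodgeConjecture.HodgeConjecture.Cruxes.H413.F0P3cDyRamEightfoldOddCharacterSocket (sum_kappaChar_mul_eq_sum_kappaChar_mul_compl)
open Summit.HodgeConjecture.HodgeConjecture.Cruxes.H413.F0P3cDyRamStableSumSignClasses (normSign_eq_one_or exists_norm_of_normSign_eq_one not_exists_norm_of_normSign_eq_neg_one exists_rep_of_dichotomy)
open scoped Valued WithZero Matrix MatrixGroups

/-! ## §1  The index-two dichotomy for an arbitrary fixed non-norm unit; the flipped representative -/

section Dichotomy

variable {K : Type} [Field K]

/-- **THE DICHOTOMY TRANSFERS TO ANY NON-NORM.**  If a `σ`-fixed `c ≠ 0` satisfies the index-two dichotomy (every non-zero `σ`-fixed `x` is a norm `z·σz` or `c·x` is) and `u` is a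
`σ`-fixed non-norm, then `u` satisfies the same dichotomy: `x` non-norm ⇒ `c·x`, `c·u` norms ⇒ `u·x = (c u)(c x)∕c²` a norm. [cite: Serre1979, Ch. V §3 Cor. 3] -/
theorem dichotomy_of_nonnorm {σ : K →+* K} {c u : K} (hσc : σ c = c) (hc0 : c ≠ 0)
    (hdich : ∀ x : K, σ x = x → x ≠ 0 → (∃ z : K, z * σ z = x) ∨ ∃ z : K, z * σ z = c * x)
    (hσu : σ u = u) (hu0 : u ≠ 0) (hun : ¬ ∃ z : K, z * σ z = u) :
    ∀ x : K, σ x = x → x ≠ 0 → (∃ z : K, z * σ z = x) ∨ ∃ z : K, z * σ z = u * x := by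
  intro x hσx hx0
  rcases hdich x hσx hx0 with h | ⟨z, hz⟩
  · exact Or.inl h
  · right
    rcases hdich u hσu hu0 with h' | ⟨w, hw⟩
    · exact absurd h' hun
    · refine ⟨w * z / c, ?_⟩
      rw [map_div₀, map_mul, hσc]
      field_simp
      linear_combination (z * σ z) * hw + (c * u) * hz

/-- **THE FLIPPED REPRESENTATIVE.**  Under the dichotomy for the `σ`-fixed unit `u`, a non-zero `σ`-fixed `x` satisfies `σz · r′ · z = u⁻¹·x` with `r′ = 1` if `ω(x) = −1` and
`r′ = u` if `ω(x) = 1` (`z = w∕u` where `w·σw = u·x`, resp. `= x`). [cite: Jacobowitz1962, §4] [cite: Serre1979, Ch. V §3 Cor. 3] -/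
theorem exists_rep_inv_mul (σ : K →+* K) {u : K} (hσu : σ u = u) (hu0 : u ≠ 0)
    (hdich : ∀ x : K, σ x = x → x ≠ 0 → (∃ z : K, z * σ z = x) ∨ ∃ z : K, z * σ z = u * x)
    {x : K} (hσx : σ x = x) (hx0 : x ≠ 0) :
    ∃ z : K, z ≠ 0 ∧ σ z * (if normSign σ x = -1 then (1 : K) else u) * z = u⁻¹ * x := by
  rcases normSign_eq_one_or σ x with h1 | h1
  · obtain ⟨w, hw⟩ := exists_norm_of_normSign_eq_one σ h1
    have hw0 : w ≠ 0 := fun h0 => hx0 (by rw [← hw, h0, zero_mul])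
    refine ⟨w / u, div_ne_zero hw0 hu0, ?_⟩
    rw [h1, if_neg (by norm_num), map_div₀, hσu]
    field_simp
    linear_combination hw
  · have hxn := not_exists_norm_of_normSign_eq_neg_one σ h1
    rcases hdich x hσx hx0 with hn | ⟨w, hw⟩
    · exact absurd hn hxn
    · have hw0 : w ≠ 0 := fun h0 => by
        have : u * x = 0 := by rw [← hw, h0, zero_mul]
        exact hx0 ((mul_eq_zero.1 this).resolve_left hu0)
      refine ⟨w / u, div_ne_zero hw0 hu0, ?_⟩
      rw [h1, if_pos rfl, map_div₀, hσu]
      field_simp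
      linear_combination hw

end Dichotomy

/-! ## §2  ★ p860071's generic currency at `s = (α, β, 1)` = the binary norm-form currency -/

section Binary

variable {K : Type} [Field K] [Valued K ℤᵐ⁰]

omit [Valued K ℤᵐ⁰] in
/-- The three tokens of ★ p860071 §2–§4 at `s = (α, β, 1)` in binary form: `diag(s−1) = diag(α−1, β−1, 0)`, `diag((s−1)²) = diag((α−1)², (β−1)², 0)`,
`Σ_i σ(y_i)c_i((s_i−1)y_i) = c₀(α−1)N(y₀) + c₁(β−1)N(y₁)`. [cite: Jacobowitz1962, §4] -/
theorem tokens_three_binary (σ : K →+* K) (c : Fin 3 → K) (α β : K) :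
    ((fun i => (![α, β, 1] : Fin 3 → K) i - 1) = ![α - 1, β - 1, 0]) ∧
    ((fun i => ((![α, β, 1] : Fin 3 → K) i - 1) * ((![α, β, 1] : Fin 3 → K) i - 1)) = ![(α - 1) * (α - 1), (β - 1) * (β - 1), 0]) ∧
    ∀ y : Fin 3 → K, (∑ i, σ (y i) * c i * (((![α, β, 1] : Fin 3 → K) i - 1) * y i)) =
      c 0 * (α - 1) * (y 0 * σ (y 0)) + c 1 * (β - 1) * (y 1 * σ (y 1)) := by
  refine ⟨?_, ?_, fun y => ?_⟩
  · funext i; fin_cases i <;> simp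
  · funext i; fin_cases i <;> simp
  · simp only [Fin.sum_univ_three, Fin.isValue, Matrix.cons_val_zero, Matrix.cons_val_one, Matrix.cons_val]
    ring

/-- **THE MODEL COUNT, GENERIC ↔ BINARY CURRENCY.**  For `T = diag(α, β, 1)` the class-`e` clean-shell model count of ★ p860071 §2 (tokens `diag(s−1)`, `diag((s−1)²)`,
value `Σ σ(y_i)c_i((s_i−1)y_i)`) is the count in the binary currency of ★ p860071 §5 (tokens `diag(α−1,β−1,0)`, `diag((α−1)²,(β−1)²,0)`, value `c₀(α−1)N(y₀)+c₁(β−1)N(y₁)`).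
[cite: Jacobowitz1962, §4] [cite: Kottwitz1986BaseChangeUnits, §1 pp. 240–241] -/
theorem ncard_model_ternary_eq_binary (σ : K →+* K) (ϖ : K) (c : Fin 3 → K) (α β : K) (T : GL (Fin 3) K) (d ℓ m mc : ℕ) (e : K) :
    {M : Submodule 𝒪[K] (Fin 3 → K) | IsVertexLattice σ ϖ (Matrix.diagonal c) 0 M ∧ mapGL T M = M ∧
        ((LatticeInLevel ϖ ℓ (Matrix.diagonal fun i => (![α, β, 1] : Fin 3 → K) i - 1) M ∧
            ¬ LatticeInLevel ϖ (ℓ + 1) (Matrix.diagonal fun i => (![α, β, 1] : Fin 3 → K) i - 1) M ∧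
            LatticeInLevel ϖ mc (Matrix.diagonal fun i => ((![α, β, 1] : Fin 3 → K) i - 1) * ((![α, β, 1] : Fin 3 → K) i - 1)) M) ∧
          {v | ∃ y ∈ M, Valued.v ((ϖ ^ m)⁻¹ * (v - ∑ i, σ (y i) * c i * (((![α, β, 1] : Fin 3 → K) i - 1) * y i))) ≤ 1} =
            valueSetMod σ ϖ m (e • xPlus σ ϖ d))}.ncard =
      {M : Submodule 𝒪[K] (Fin 3 → K) | IsVertexLattice σ ϖ (Matrix.diagonal c) 0 M ∧ mapGL T M = M ∧
        ((LatticeInLevel ϖ ℓ (Matrix.diagonal ![α - 1, β - 1, 0]) M ∧ ¬ LatticeInLevel ϖ (ℓ + 1) (Matrix.diagonal ![α - 1, β - 1, 0]) M ∧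
            LatticeInLevel ϖ mc (Matrix.diagonal ![(α - 1) * (α - 1), (β - 1) * (β - 1), 0]) M) ∧
          {v | ∃ y ∈ M, Valued.v ((ϖ ^ m)⁻¹ * (v - (c 0 * (α - 1) * (y 0 * σ (y 0)) + c 1 * (β - 1) * (y 1 * σ (y 1))))) ≤ 1} =
            valueSetMod σ ϖ m (e • xPlus σ ϖ d))}.ncard := by
  obtain ⟨h1, h2, h3⟩ := tokens_three_binary σ c α β
  simp only [h1, h2, h3]

/-- **CLASS-ONLY DEPENDENCE, BINARY CURRENCY** (★ p860071 §3 at `s = (α, β, 1)`, label read `F = id`): entrywise-congruent unit diagonal models (`σz_i·c_i·z_i = c′_i`) have the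
same class-`e` clean-shell count for `T = diag(α, β, 1)`. [cite: Jacobowitz1962, §4] [cite: LanglandsShelstad1987, §3] -/
theorem ncard_cleanLabel_binary_eq_of_exists_norm (σ : K →+* K) (ϖ : K) {c c' : Fin 3 → K} (h : ∀ i, ∃ z : K, z ≠ 0 ∧ σ z * c i * z = c' i)
    (α β : K) (T : GL (Fin 3) K) (hT : (T : Matrix (Fin 3) (Fin 3) K) = Matrix.diagonal ![α, β, 1]) (d ℓ m mc : ℕ) (e : K) :
    {M : Submodule 𝒪[K] (Fin 3 → K) | IsVertexLattice σ ϖ (Matrix.diagonal c') 0 M ∧ mapGL T M = M ∧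
        ((LatticeInLevel ϖ ℓ (Matrix.diagonal ![α - 1, β - 1, 0]) M ∧ ¬ LatticeInLevel ϖ (ℓ + 1) (Matrix.diagonal ![α - 1, β - 1, 0]) M ∧
            LatticeInLevel ϖ mc (Matrix.diagonal ![(α - 1) * (α - 1), (β - 1) * (β - 1), 0]) M) ∧
          {v | ∃ y ∈ M, Valued.v ((ϖ ^ m)⁻¹ * (v - (c' 0 * (α - 1) * (y 0 * σ (y 0)) + c' 1 * (β - 1) * (y 1 * σ (y 1))))) ≤ 1} =
            valueSetMod σ ϖ m (e • xPlus σ ϖ d))}.ncard =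
      {M : Submodule 𝒪[K] (Fin 3 → K) | IsVertexLattice σ ϖ (Matrix.diagonal c) 0 M ∧ mapGL T M = M ∧
        ((LatticeInLevel ϖ ℓ (Matrix.diagonal ![α - 1, β - 1, 0]) M ∧ ¬ LatticeInLevel ϖ (ℓ + 1) (Matrix.diagonal ![α - 1, β - 1, 0]) M ∧
            LatticeInLevel ϖ mc (Matrix.diagonal ![(α - 1) * (α - 1), (β - 1) * (β - 1), 0]) M) ∧
          {v | ∃ y ∈ M, Valued.v ((ϖ ^ m)⁻¹ * (v - (c 0 * (α - 1) * (y 0 * σ (y 0)) + c 1 * (β - 1) * (y 1 * σ (y 1))))) ≤ 1} =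
            valueSetMod σ ϖ m (e • xPlus σ ϖ d))}.ncard := by
  rw [← ncard_model_ternary_eq_binary σ ϖ c', ← ncard_model_ternary_eq_binary σ ϖ c]
  exact ncard_cleanLabel_diagonal_eq_of_exists_norm σ ϖ h _ T hT d ℓ m mc e id

/-- **THE FORM-SCALING FLIP, BINARY CURRENCY** (★ p860071 §4 at `s = (α, β, 1)`): for a unit `u`, the class-`e` count of `diag(u • c)` is the class-`u⁻¹e` count of `diag(c)`.
[cite: Jacobowitz1962, §4] [cite: Kottwitz1986BaseChangeUnits, §1 pp. 240–241] -/
theorem ncard_cleanLabel_binary_smul_form (σ : K →+* K) (ϖ : K) {u : K} (hu : Valued.v u = 1) (c : Fin 3 → K)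
    (α β : K) (T : GL (Fin 3) K) (d ℓ m mc : ℕ) (e : K) :
    {M : Submodule 𝒪[K] (Fin 3 → K) | IsVertexLattice σ ϖ (Matrix.diagonal (u • c)) 0 M ∧ mapGL T M = M ∧
        ((LatticeInLevel ϖ ℓ (Matrix.diagonal ![α - 1, β - 1, 0]) M ∧ ¬ LatticeInLevel ϖ (ℓ + 1) (Matrix.diagonal ![α - 1, β - 1, 0]) M ∧
            LatticeInLevel ϖ mc (Matrix.diagonal ![(α - 1) * (α - 1), (β - 1) * (β - 1), 0]) M) ∧
          {v | ∃ y ∈ M, Valued.v ((ϖ ^ m)⁻¹ * (v - ((u • c) 0 * (α - 1) * (y 0 * σ (y 0)) + (u • c) 1 * (β - 1) * (y 1 * σ (y 1))))) ≤ 1} =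
            valueSetMod σ ϖ m (e • xPlus σ ϖ d))}.ncard =
      {M : Submodule 𝒪[K] (Fin 3 → K) | IsVertexLattice σ ϖ (Matrix.diagonal c) 0 M ∧ mapGL T M = M ∧
        ((LatticeInLevel ϖ ℓ (Matrix.diagonal ![α - 1, β - 1, 0]) M ∧ ¬ LatticeInLevel ϖ (ℓ + 1) (Matrix.diagonal ![α - 1, β - 1, 0]) M ∧
            LatticeInLevel ϖ mc (Matrix.diagonal ![(α - 1) * (α - 1), (β - 1) * (β - 1), 0]) M) ∧
          {v | ∃ y ∈ M, Valued.v ((ϖ ^ m)⁻¹ * (v - (c 0 * (α - 1) * (y 0 * σ (y 0)) + c 1 * (β - 1) * (y 1 * σ (y 1))))) ≤ 1} =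
            valueSetMod σ ϖ m ((u⁻¹ * e) • xPlus σ ϖ d))}.ncard := by
  rw [← ncard_model_ternary_eq_binary σ ϖ (u • c), ← ncard_model_ternary_eq_binary σ ϖ c]
  exact ncard_cleanLabel_diagonal_smul_form σ ϖ hu c _ T d ℓ m mc e

end Binary

/-! ## §3  The parity of the frame patterns -/

/-- **THE FRAME PATTERNS HAVE CONSTANT PARITY.**  For signs `ε₁, ε₂, w ∈ {±1}` (as integers), the pattern `(ε₁ = −1, ε₂ = −1, w·ε₁·ε₂ = −1)` has parity `[w = −1]` — independent
of `(ε₁, ε₂)`. [cite: LanglandsShelstad1987, §1.3] [cite: Rogawski1990, §3.6 pp. 28–29] -/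
theorem xor_pattern_eq {ε₁ ε₂ w : ℤ} (h₁ : ε₁ = 1 ∨ ε₁ = -1) (h₂ : ε₂ = 1 ∨ ε₂ = -1) (hw : w = 1 ∨ w = -1) :
    (decide (ε₁ = -1) ^^ decide (ε₂ = -1) ^^ decide (w * ε₁ * ε₂ = -1)) = decide (w = -1) := by
  rcases h₁ with rfl | rfl <;> rcases h₂ with rfl | rfl <;> rcases hw with rfl | rfl <;> decide

/-! ## §4  HEAD: (β-BAL) from the eightfold odd-character vanishing -/

section Head

variable {K : Type} [Field K] [Valued K ℤᵐ⁰] [CompleteSpace K] [Fintype 𝓀[K]]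

/-- **HEAD — `CleanLabelKappaBalanceLawAt N₀ mc σ ϖ d t` FROM THE EIGHTFOLD ODD-CHARACTER VANISHING.**  Suppose that, behind the datum, for every `σ`-fixed non-norm unit `u`
with the index-two dichotomy, every element datum `(α, β; n)` above `N₀ d`, `T = diag(α, β, 1)` and each slot `i : Fin 3`, the signed eightfold sum
`Σ_{s : Fin 3 → Bool} (−1)^{s_i} · #{M : type-0 vertex of (K³, diag(u^{s})) | T·M = M, diag(α−1,β−1,0)·M ⊆ ϖ^{d%2}M ⊄ ϖ^{d%2+1}M, diag((α−1)²,(β−1)²,0)·M ⊆ ϖ^{mc d}M,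
{u^{s₀}(α−1)N(y₀) + u^{s₁}(β−1)N(y₁) | y ∈ M} + ϖ^{m*}𝒪 = valueSetMod σ ϖ m* X₊}` vanishes (`m* = mstarOfRecord d`; `u^{s_j} = u` if `s_j` else `1`).  Then (β-BAL) holds
at `(N₀, mc)`: for every four-frame family, element datum, frame literals `Γ_b`, non-norm `u` and `i`, `Σ_b κ_i(b)·cleanLabelFixCount…1 (Γ_b) = Σ_b κ_i(b)·cleanLabelFixCount…u (Γ_b)`.
[cite: LanglandsShelstad1987, §1.3, §3] [cite: Kottwitz1986BaseChangeUnits, §1 pp. 240–241] [cite: Rogawski1990, §4.9 Prop. 4.9.1 (a)(b) p. 55] [cite: Serre1979, Ch. V §3 Cor. 3] -/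
theorem cleanLabelKappaBalanceLawAt_of_eightfold (N₀ mc : ℕ → ℕ) (σ : K →+* K) (ϖ : K) (d t : ℕ)
    (h8 : IsRamifiedQuadraticDatum σ ϖ d t →
      ∀ (u : K), σ u = u → Valued.v u = 1 → (¬ ∃ z : K, z * σ z = u) →
        (∀ x : K, σ x = x → x ≠ 0 → (∃ z : K, z * σ z = x) ∨ ∃ z : K, z * σ z = u * x) →
      ∀ (α β : K) (n₁ n₂ n₃ : ℕ), IsElementDatum σ ϖ (N₀ d) α β n₁ n₂ n₃ →
      ∀ (T : GL (Fin 3) K), (T : Matrix (Fin 3) (Fin 3) K) = Matrix.diagonal ![α, β, 1] →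
      ∀ i : Fin 3,
        (∑ s : Fin 3 → Bool, (if s i then (-1 : ℤ) else 1) *
          ({M : Submodule 𝒪[K] (Fin 3 → K) | IsVertexLattice σ ϖ (Matrix.diagonal fun j => if s j then u else (1 : K)) 0 M ∧ mapGL T M = M ∧
              ((LatticeInLevel ϖ (d % 2) (Matrix.diagonal ![α - 1, β - 1, 0]) M ∧ ¬ LatticeInLevel ϖ (d % 2 + 1) (Matrix.diagonal ![α - 1, β - 1, 0]) M ∧
                  LatticeInLevel ϖ (mc d) (Matrix.diagonal ![(α - 1) * (α - 1), (β - 1) * (β - 1), 0]) M) ∧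
                {v | ∃ y ∈ M, Valued.v ((ϖ ^ mstarOfRecord d)⁻¹ *
                    (v - ((if s 0 then u else (1 : K)) * (α - 1) * (y 0 * σ (y 0)) + (if s 1 then u else (1 : K)) * (β - 1) * (y 1 * σ (y 1))))) ≤ 1} =
                  valueSetMod σ ϖ (mstarOfRecord d) (xPlus σ ϖ d))}.ncard : ℤ)) = 0) :
    CleanLabelKappaBalanceLawAt N₀ mc σ ϖ d t := by
  classical
  intro hD f hf α β n₁ n₂ n₃ hE Γ hΓ u hσu hvu hun i
  obtain ⟨hσ, hvσ, hϖ, heven, -, -, -⟩ := id hD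
  have hu0 : u ≠ 0 := fun h => by rw [h, map_zero] at hvu; exact zero_ne_one hvu
  -- (NI2) and the dichotomy for `u`
  obtain ⟨c₀, hσc₀, hvc₀, hdich₀⟩ := F0P3cDyRamNormIndexTwo.normIndexTwo σ ϖ d t hD
  have hc₀0 : c₀ ≠ 0 := fun h => by rw [h, map_zero] at hvc₀; exact zero_ne_one hvc₀
  have hdich : ∀ x : K, σ x = x → x ≠ 0 → (∃ z : K, z * σ z = x) ∨ ∃ z : K, z * σ z = u * x :=
    dichotomy_of_nonnorm hσc₀ hc₀0 hdich₀ hσu hu0 hun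
  -- `α, β` are units; the diagonal literal `T = diag(α, β, 1)`
  have hα0 : α ≠ 0 := fun h => by have h1 := hE.1; rw [h, zero_mul] at h1; exact zero_ne_one h1
  have hβ0 : β ≠ 0 := fun h => by have h1 := hE.2.1; rw [h, zero_mul] at h1; exact zero_ne_one h1
  let T : GL (Fin 3) K :=
    ⟨Matrix.diagonal ![α, β, 1], Matrix.diagonal ![α⁻¹, β⁻¹, 1],
      by rw [Matrix.diagonal_mul_diagonal, ← Matrix.diagonal_one]; congr 1; funext j; fin_cases j <;> simp [hα0, hβ0],
      by rw [Matrix.diagonal_mul_diagonal, ← Matrix.diagonal_one]; congr 1; funext j; fin_cases j <;> simp [hα0, hβ0]⟩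
  have hT : (T : Matrix (Fin 3) (Fin 3) K) = Matrix.diagonal ![α, β, 1] := rfl
  -- the pattern counts
  let N : (Fin 3 → Bool) → ℤ := fun s =>
    ({M : Submodule 𝒪[K] (Fin 3 → K) | IsVertexLattice σ ϖ (Matrix.diagonal fun j => if s j then u else (1 : K)) 0 M ∧ mapGL T M = M ∧
        ((LatticeInLevel ϖ (d % 2) (Matrix.diagonal ![α - 1, β - 1, 0]) M ∧ ¬ LatticeInLevel ϖ (d % 2 + 1) (Matrix.diagonal ![α - 1, β - 1, 0]) M ∧
            LatticeInLevel ϖ (mc d) (Matrix.diagonal ![(α - 1) * (α - 1), (β - 1) * (β - 1), 0]) M) ∧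
          {v | ∃ y ∈ M, Valued.v ((ϖ ^ mstarOfRecord d)⁻¹ *
              (v - ((if s 0 then u else (1 : K)) * (α - 1) * (y 0 * σ (y 0)) + (if s 1 then u else (1 : K)) * (β - 1) * (y 1 * σ (y 1))))) ≤ 1} =
            valueSetMod σ ϖ (mstarOfRecord d) (xPlus σ ϖ d))}.ncard : ℤ)
  have hN : ∀ j : Fin 3, (∑ s : Fin 3 → Bool, (if s j then (-1 : ℤ) else 1) * N s) = 0 :=
    fun j => h8 hD u hσu hvu hun hdich α β n₁ n₂ n₃ hE T hT j
  -- the frame models (★ p860071 §5): one `c b` per frame, for every class `e`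
  choose c hc1 hσc hcls hcount using fun b => exists_diagonal_model_cleanLabelFixCount (ϖ := ϖ) hσ hvσ hϖ heven hf b
  have hc0 : ∀ b j, c b j ≠ 0 := fun b j h => by have := hc1 b j; rw [h, map_zero] at this; exact zero_ne_one this
  -- the frame patterns and their parity
  let e : Fin 4 → Fin 3 → Bool := fun b j => decide (normSign σ (c b j) = -1)
  have hpar : ∀ b : Fin 4, (e b 0 ^^ e b 1 ^^ e b 2) = (e 0 0 ^^ e 0 1 ^^ e 0 2) := by
    have key : ∀ b : Fin 4, (e b 0 ^^ e b 1 ^^ e b 2) = decide (normSign σ (-1 : K) = -1) := by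
      intro b
      obtain ⟨-, -, h0, h1, h2⟩ := hf b
      have hsp : ((signPair b).1 = 1 ∨ (signPair b).1 = -1) ∧ ((signPair b).2 = 1 ∨ (signPair b).2 = -1) := by
        fin_cases b <;> simp [signPair]
      change (decide (normSign σ (c b 0) = -1) ^^ decide (normSign σ (c b 1) = -1) ^^ decide (normSign σ (c b 2) = -1)) = _
      rw [hcls b 0, hcls b 1, hcls b 2, h0, h1, h2]
      exact xor_pattern_eq hsp.1 hsp.2 (normSign_eq_one_or σ (-1 : K))
    intro b; rw [key b, key 0]
  -- (A⁺) the class-`1` count of frame `b` is the pattern count `N (e b)`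
  have hplus : ∀ b : Fin 4, (cleanLabelFixCount σ ϖ d (d % 2) (mstarOfRecord d) (mc d) 1 (Γ b) : ℤ) = N (e b) := by
    intro b
    have hrep : ∀ j, ∃ z : K, z ≠ 0 ∧ σ z * (fun j => if e b j then u else (1 : K)) j * z = c b j := by
      intro j
      obtain ⟨z, hz0, hz⟩ := exists_rep_of_dichotomy σ hσu hu0 hdich (hσc b j) (hc0 b j)
      refine ⟨z, hz0, ?_⟩
      simpa only [e, decide_eq_true_eq] using hz
    rw [hcount b α β T (Γ b) hT (hΓ b) d (d % 2) (mstarOfRecord d) (mc d) 1,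
      ncard_cleanLabel_binary_eq_of_exists_norm σ ϖ hrep α β T hT d (d % 2) (mstarOfRecord d) (mc d) 1]
    simp only [N, one_smul]
  -- (A⁻) the class-`u` count of frame `b` is the complementary pattern count `N (ē b)`
  have hminus : ∀ b : Fin 4, (cleanLabelFixCount σ ϖ d (d % 2) (mstarOfRecord d) (mc d) u (Γ b) : ℤ) = N (fun j => !e b j) := by
    intro b
    have hrep : ∀ j, ∃ z : K, z ≠ 0 ∧ σ z * (fun j => if (!e b j) then u else (1 : K)) j * z = (u⁻¹ • c b) j := by
      intro j
      obtain ⟨z, hz0, hz⟩ := exists_rep_inv_mul σ hσu hu0 hdich (hσc b j) (hc0 b j)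
      refine ⟨z, hz0, ?_⟩
      rw [Pi.smul_apply, smul_eq_mul]
      by_cases hs : normSign σ (c b j) = -1
      · rw [if_pos hs] at hz
        simpa only [e, hs, decide_true, Bool.not_true, Bool.false_eq_true, ↓reduceIte] using hz
      · rw [if_neg hs] at hz
        simpa only [e, hs, decide_false, Bool.not_false, ↓reduceIte] using hz
    have hsmul : c b = u • (u⁻¹ • c b) := by rw [smul_smul, mul_inv_cancel₀ hu0, one_smul]
    rw [hcount b α β T (Γ b) hT (hΓ b) d (d % 2) (mstarOfRecord d) (mc d) u]
    conv_lhs => rw [hsmul]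
    rw [ncard_cleanLabel_binary_smul_form σ ϖ hvu (u⁻¹ • c b) α β T d (d % 2) (mstarOfRecord d) (mc d) u, inv_mul_cancel₀ hu0,
      ncard_cleanLabel_binary_eq_of_exists_norm σ ϖ hrep α β T hT d (d % 2) (mstarOfRecord d) (mc d) 1]
    simp only [N, one_smul]
  -- assembly through the socket
  simp_rw [hplus, hminus]
  exact sum_kappaChar_mul_eq_sum_kappaChar_mul_compl N hN e hpar i

end Head

/-! ## §5  The fenced forms; the record letters -/

section Fenced

variable {K : Type} [Field K] [Valued K ℤᵐ⁰] [CompleteSpace K] [Fintype 𝓀[K]]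

/-- **FENCED FORM.**  Behind the dyadic fence `|2| < 1`: the fenced eightfold odd-character vanishing gives `DyadicFence (CleanLabelKappaBalanceLawAt N₀ mc σ ϖ d t)`.
[cite: LanglandsShelstad1987, §1.3, §3] [cite: Rogawski1990, §4.9 Prop. 4.9.1 (a)(b) p. 55] -/
theorem dyadicFence_cleanLabelKappaBalanceLawAt_of_eightfold (N₀ mc : ℕ → ℕ) (σ : K →+* K) (ϖ : K) (d t : ℕ)
    (h8 : Valued.v (2 : K) < 1 → IsRamifiedQuadraticDatum σ ϖ d t →
      ∀ (u : K), σ u = u → Valued.v u = 1 → (¬ ∃ z : K, z * σ z = u) →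
        (∀ x : K, σ x = x → x ≠ 0 → (∃ z : K, z * σ z = x) ∨ ∃ z : K, z * σ z = u * x) →
      ∀ (α β : K) (n₁ n₂ n₃ : ℕ), IsElementDatum σ ϖ (N₀ d) α β n₁ n₂ n₃ →
      ∀ (T : GL (Fin 3) K), (T : Matrix (Fin 3) (Fin 3) K) = Matrix.diagonal ![α, β, 1] →
      ∀ i : Fin 3,
        (∑ s : Fin 3 → Bool, (if s i then (-1 : ℤ) else 1) *
          ({M : Submodule 𝒪[K] (Fin 3 → K) | IsVertexLattice σ ϖ (Matrix.diagonal fun j => if s j then u else (1 : K)) 0 M ∧ mapGL T M = M ∧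
              ((LatticeInLevel ϖ (d % 2) (Matrix.diagonal ![α - 1, β - 1, 0]) M ∧ ¬ LatticeInLevel ϖ (d % 2 + 1) (Matrix.diagonal ![α - 1, β - 1, 0]) M ∧
                  LatticeInLevel ϖ (mc d) (Matrix.diagonal ![(α - 1) * (α - 1), (β - 1) * (β - 1), 0]) M) ∧
                {v | ∃ y ∈ M, Valued.v ((ϖ ^ mstarOfRecord d)⁻¹ *
                    (v - ((if s 0 then u else (1 : K)) * (α - 1) * (y 0 * σ (y 0)) + (if s 1 then u else (1 : K)) * (β - 1) * (y 1 * σ (y 1))))) ≤ 1} =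
                  valueSetMod σ ϖ (mstarOfRecord d) (xPlus σ ϖ d))}.ncard : ℤ)) = 0) :
    DyadicFence (K := K) (CleanLabelKappaBalanceLawAt N₀ mc σ ϖ d t) :=
  fun h2 => cleanLabelKappaBalanceLawAt_of_eightfold N₀ mc σ ϖ d t (h8 h2)

/-- **AT THE RECORD LETTERS** (`N₀ = n0DerivedOfRecord`, `mc = mcOfRecord`): the fenced eightfold odd-character vanishing at the derived letters, for every datum, gives EXACTLY the
type of LH4-p05 (g8)'s `hbal` binder ∕ the (β-BAL) END `∀ σ ϖ d t, DyadicFence (CleanLabelKappaBalanceLawAt n0DerivedOfRecord mcOfRecord σ ϖ d t)`.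
[cite: LanglandsShelstad1987, §1.3, §3] [cite: Rogawski1990, §4.9 Prop. 4.9.1 (a)(b) p. 55] -/
theorem dyadicFence_cleanLabelKappaBalanceLawAt_derived_ofRecord_of_eightfold
    (h8 : ∀ {K : Type} [Field K] [Valued K ℤᵐ⁰] [CompleteSpace K] [Fintype 𝓀[K]] (σ : K →+* K) (ϖ : K) (d t : ℕ),
      Valued.v (2 : K) < 1 → IsRamifiedQuadraticDatum σ ϖ d t →
      ∀ (u : K), σ u = u → Valued.v u = 1 → (¬ ∃ z : K, z * σ z = u) →
        (∀ x : K, σ x = x → x ≠ 0 → (∃ z : K, z * σ z = x) ∨ ∃ z : K, z * σ z = u * x) →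
      ∀ (α β : K) (n₁ n₂ n₃ : ℕ), IsElementDatum σ ϖ (n0DerivedOfRecord d) α β n₁ n₂ n₃ →
      ∀ (T : GL (Fin 3) K), (T : Matrix (Fin 3) (Fin 3) K) = Matrix.diagonal ![α, β, 1] →
      ∀ i : Fin 3,
        (∑ s : Fin 3 → Bool, (if s i then (-1 : ℤ) else 1) *
          ({M : Submodule 𝒪[K] (Fin 3 → K) | IsVertexLattice σ ϖ (Matrix.diagonal fun j => if s j then u else (1 : K)) 0 M ∧ mapGL T M = M ∧
              ((LatticeInLevel ϖ (d % 2) (Matrix.diagonal ![α - 1, β - 1, 0]) M ∧ ¬ LatticeInLevel ϖ (d % 2 + 1) (Matrix.diagonal ![α - 1, β - 1, 0]) M ∧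
                  LatticeInLevel ϖ (mcOfRecord d) (Matrix.diagonal ![(α - 1) * (α - 1), (β - 1) * (β - 1), 0]) M) ∧
                {v | ∃ y ∈ M, Valued.v ((ϖ ^ mstarOfRecord d)⁻¹ *
                    (v - ((if s 0 then u else (1 : K)) * (α - 1) * (y 0 * σ (y 0)) + (if s 1 then u else (1 : K)) * (β - 1) * (y 1 * σ (y 1))))) ≤ 1} =
                  valueSetMod σ ϖ (mstarOfRecord d) (xPlus σ ϖ d))}.ncard : ℤ)) = 0) :
    ∀ {K : Type} [Field K] [Valued K ℤᵐ⁰] [CompleteSpace K] [Fintype 𝓀[K]] (σ : K →+* K) (ϖ : K) (d t : ℕ),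
      DyadicFence (K := K) (CleanLabelKappaBalanceLawAt n0DerivedOfRecord mcOfRecord σ ϖ d t) :=
  fun σ ϖ d t => dyadicFence_cleanLabelKappaBalanceLawAt_of_eightfold n0DerivedOfRecord mcOfRecord σ ϖ d t (h8 σ ϖ d t)

end Fenced

end Summit.HodgeConjecture.HodgeConjecture.Cruxes.H413.F0P3cDyRamCleanLabelBalanceOfEightfold

end
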